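import Summits.RiemannHypothesis.RiemannHypothesis.Theorems.TiltedLandingLaw421R3BudgetCornerSplit

/-!
# K-2 budget, CASE (B1) CLOSED on the nine numbers: `t_v < 3/2 ∧ t_z ≥ 5` (C1 g35, W-08 ⟨33346⟩; compactification lemma (L2) / memo v2 §4 (B1))

With `t_w := −Im w·Im K_w`: if `t_v < 3/2` (case (A) excluded) and `t_z ≥ 5` (the taller state's drop parameter large), the conclusion of
`GeometricBudget 10 μ₀` (`μ₀ ≤ 1/2`) holds: the v-disc costs at most `3 + 1/5` (`vdisc_mid`: `2t_v − 1/5 ≤ V`, `t_v ≥ −3/2` by the separated pull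
`pairPull v z ≤ 2/Im v`), the z-disc pays `≥ (17/25)·(460/47) − 5/λ ≈ 6.65 − 5/λ` (`zdisc_tail` + the WEIGHT RATIO `(17/25)‖K_z‖² ≤ κ²` from coherence +
J's z-doors).  With images J/K: **`GeometricBudget 10 μ₀` (`μ₀ ≤ 1/2`) follows from its restriction to the PERTURBATIVE BOX `t_v < 3/2 ∧ t_z < 5`**
(`geometricBudget_ten_of_box`) — instr-1's E2 object exactly (compactification note (L1)+(L2) discharged in the kernel; (L3) β-tail and (L4) ε stay E2's).
STATUS: support; `GeometricBudget 10 (1/2)` is NOT proved.  Nothing here bears on the truth of RH; RH is not proved; 33346 / 33347 OPEN. -/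

namespace RhW08.BudgetCaseB1

open Complex
open scoped ComplexConjugate
open RhW08.UncoveredSign (pairPull)
open RhW08.LightPairDrop (GeometricBudget im_explicit im_mul_norm_ge)
open RhW08.BudgetAlgebra (energy_drop_closedDisc neg_im_mul_le normSq_tilt_t)
open RhW08.LightIsolatedChild (im_newtonPoint)
open RhW08.BudgetCaseA (explicit_coherence im_Kz_le zdoors_real)
open RhW08.BudgetCornerSplit (GeometricBudgetOn geometricBudget_ten_of_tv_lt geometricBudgetOn_of_split geometricBudgetOn_mono)

/-! ## §1 The v-disc in the middle range `|t_v| ≤ 3/2` -/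

set_option maxHeartbeats 400000 in
/-- §1 (real core) `k ≥ 30`, `0 < L`, `L² = k² + t − 1/4`, `|t| ≤ 3/2`, `0 ≤ μ₀ ≤ 1/2` ⇒
`2t − 1/5 ≤ 2tk²/L² − k²t²/L⁴ − (36/5)μ₀k²/L³ − (81/25)μ₀²k²/L⁶`. -/
theorem vdisc_mid_real {k L t μ₀ : ℝ} (hk : 30 ≤ k) (hL0 : 0 < L) (hkL : L ^ 2 = k ^ 2 + t - 1 / 4) (ht1 : -(3 / 2) ≤ t) (ht2 : t ≤ 3 / 2)
    (hμ0 : 0 ≤ μ₀) (hμ : μ₀ ≤ 1 / 2) :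
    2 * t - 1 / 5 ≤ 2 * t * k ^ 2 / L ^ 2 - k ^ 2 * t ^ 2 / L ^ 4 - (36 / 5) * μ₀ * k ^ 2 / L ^ 3 - (81 / 25) * μ₀ ^ 2 * k ^ 2 / L ^ 6 := by
  have hk2 : k ^ 2 = L ^ 2 - t + 1 / 4 := by linarith
  have hL2 : 898 ≤ L ^ 2 := by nlinarith
  have hL29 : 29 ≤ L := by nlinarith
  have hL2p : 0 < L ^ 2 := by positivity
  have hL3 : 0 < L ^ 3 := by positivity
  have hL4 : 0 < L ^ 4 := by positivity
  have hL6 : 0 < L ^ 6 := by positivity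
  -- main terms ≥ 2t − 8/L²
  have hq : 0 ≤ (3 / 2 - t) * (t + 3 / 2) := mul_nonneg (by linarith) (by linarith)
  have hA : 1 / 2 ≤ 8 + t / 2 - 3 * t ^ 2 := by nlinarith
  have hB : -4 ≤ t ^ 3 - t ^ 2 / 4 := by nlinarith [mul_nonneg (by linarith : 0 ≤ t + 3 / 2) (sq_nonneg (t - 3 / 4))]
  have hpoly : 2 * t * L ^ 4 - 8 * L ^ 2 ≤ 2 * t * k ^ 2 * L ^ 2 - k ^ 2 * t ^ 2 := by
    rw [hk2]
    nlinarith [mul_le_mul_of_nonneg_left hA hL2p.le]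
  have hmain : 2 * t - 8 / L ^ 2 ≤ 2 * t * k ^ 2 / L ^ 2 - k ^ 2 * t ^ 2 / L ^ 4 := by
    have e1 : 2 * t - 8 / L ^ 2 = (2 * t * L ^ 4 - 8 * L ^ 2) / L ^ 4 := by field_simp
    have e2 : 2 * t * k ^ 2 / L ^ 2 - k ^ 2 * t ^ 2 / L ^ 4 = (2 * t * k ^ 2 * L ^ 2 - k ^ 2 * t ^ 2) / L ^ 4 := by field_simp
    rw [e1, e2]
    exact div_le_div_of_nonneg_right hpoly hL4.le
  -- doors
  have hk2b : k ^ 2 ≤ L ^ 2 + 7 / 4 := by linarith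
  have hd1 : (36 / 5) * μ₀ * k ^ 2 / L ^ 3 ≤ (361 / 100) / L := by
    rw [div_le_div_iff₀ hL3 hL0]
    have : μ₀ * k ^ 2 ≤ (1 / 2) * (L ^ 2 + 7 / 4) := by nlinarith [mul_le_mul hμ hk2b (sq_nonneg k) (by norm_num : (0:ℝ) ≤ 1 / 2)]
    nlinarith
  have hd2 : (81 / 25) * μ₀ ^ 2 * k ^ 2 / L ^ 6 ≤ (1 / 100) / L := by
    rw [div_le_div_iff₀ hL6 hL0]
    have hμ2 : μ₀ ^ 2 ≤ 1 / 4 := by nlinarith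
    have h1 : μ₀ ^ 2 * k ^ 2 ≤ (1 / 4) * (L ^ 2 + 7 / 4) := by
      nlinarith [mul_le_mul hμ2 hk2b (sq_nonneg k) (by norm_num : (0:ℝ) ≤ 1 / 4)]
    have hL3' : 24389 ≤ L ^ 3 := by nlinarith [pow_le_pow_left₀ (by norm_num) hL29 3]
    have e : L ^ 6 = L ^ 3 * L ^ 3 := by ring
    nlinarith [mul_le_mul_of_nonneg_left hL3' hL3.le]
  -- bookkeeping: 8/L² + 3.62/L ≤ 1/5
  have hb1 : 8 / L ^ 2 ≤ (8 / 29) / L := by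
    rw [div_le_div_iff₀ hL2p hL0]; nlinarith
  have hb2 : (8 / 29) / L + (361 / 100) / L + (1 / 100) / L ≤ 1 / 5 := by
    rw [← add_div, ← add_div, div_le_iff₀ hL0]; nlinarith
  linarith

/-- §1 the separated pull at the LOWER state: `Im v ≤ 2‖v − z‖`, `Im v < Im z` ⇒ `pairPull v z ≤ 2/Im v` (so `T_v ≥ −3`). -/
theorem pairPull_le_of_sep {v z : ℂ} (hv : 0 < v.im) (hvz : v.im < z.im) (hsep : v.im ≤ 2 * ‖v - z‖) : pairPull v z ≤ 2 / v.im := by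
  have hb : 0 < z.im := hv.trans hvz
  have hn : 0 < ‖v - z‖ := by linarith
  have h1 : (z.im + v.im) / Complex.normSq (v - conj z) ≥ 0 := by
    apply div_nonneg (by linarith) (Complex.normSq_nonneg _)
  have h2 : (z.im - v.im) / Complex.normSq (v - z) ≤ 1 / ‖v - z‖ := by
    have him : z.im - v.im ≤ ‖v - z‖ := by
      have h := Complex.abs_im_le_norm (v - z)
      rw [sub_im, abs_sub_comm, abs_of_pos (by linarith : 0 < z.im - v.im)] at h
      exact h
    rw [Complex.normSq_eq_norm_sq, div_le_div_iff₀ (by positivity) hn]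
    nlinarith
  have h3 : 1 / ‖v - z‖ ≤ 2 / v.im := by
    rw [div_le_div_iff₀ hn hv]; linarith
  have e : pairPull v z = (z.im - v.im) / Complex.normSq (v - z) - (z.im + v.im) / Complex.normSq (v - conj z) := rfl
  linarith

/-- §1 THE v-DISC IN THE MIDDLE RANGE: `−3/2 ≤ t_v ≤ 3/2` (`t_v = −Im v·Im K`), floor `30 ≤ Im v·κ`, closed sharp door, `0 ≤ μ₀ ≤ 1/2` ⇒
`2t_v − 1/5 ≤ (Im v² − Im u²)·κ²`. -/
theorem vdisc_mid {v K u : ℂ} {μ₀ : ℝ} (hv : 0 < v.im) (hμ0 : 0 ≤ μ₀) (hμ : μ₀ ≤ 1 / 2)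
    (hfl : 30 ≤ v.im * ‖K + I / (2 * (v.im : ℂ))‖) (ht1 : -(3 / 2) ≤ -(v.im * K.im)) (ht2 : -(v.im * K.im) ≤ 3 / 2)
    (hd : ‖u - (v - K⁻¹)‖ ≤ (9 / 5) * (μ₀ / (v.im * ‖K‖) ^ 2) / ‖K‖) :
    2 * (-(v.im * K.im)) - 1 / 5 ≤ (v.im ^ 2 - u.im ^ 2) * ‖K + I / (2 * (v.im : ℂ))‖ ^ 2 := by
  set a := v.im with ha
  set n := ‖K‖ with hn
  set κ := ‖K + I / (2 * (a : ℂ))‖ with hκ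
  set t := -(a * K.im) with htdef
  set δ := (9 / 5) * (μ₀ / (a * n) ^ 2) / n with hδ
  have hL : a * κ - 1 / 2 ≤ a * n := im_mul_norm_ge hv
  have hL1 : 29 ≤ a * n := by linarith
  have hn0 : 0 < n := by
    by_contra h
    have : n = 0 := le_antisymm (not_lt.mp h) (norm_nonneg _)
    rw [this, mul_zero] at hL1; linarith
  have hK0 : K ≠ 0 := norm_pos_iff.mp hn0
  have hκ2 : κ ^ 2 = n ^ 2 - (t - 1 / 4) / a ^ 2 := normSq_tilt_t K hv.ne'
  have hδ0 : 0 ≤ δ := by positivity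
  have hkL : (a * n) ^ 2 = (a * κ) ^ 2 + t - 1 / 4 := by
    rw [mul_pow, mul_pow, hκ2]; field_simp; ring
  -- centre height within 2a
  have hc : |(v - K⁻¹).im| ≤ 2 * a := by
    rw [im_newtonPoint]
    have e : K.im = -t / a := by rw [htdef]; field_simp
    have e2 : a + K.im / n ^ 2 = a - t / (a * n ^ 2) := by rw [e]; field_simp; ring
    have hb : |t / (a * n ^ 2)| ≤ a := by
      rw [abs_div, abs_of_pos (by positivity : 0 < a * n ^ 2), div_le_iff₀ (by positivity)]
      have : |t| ≤ 3 / 2 := abs_le.mpr ⟨ht1, ht2⟩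
      nlinarith [mul_nonneg hv.le hn0.le]
    rw [← ha, e2]
    calc |a - t / (a * n ^ 2)| ≤ |a| + |t / (a * n ^ 2)| := abs_sub _ _
      _ ≤ 2 * a := by rw [abs_of_pos hv]; linarith
  have hdrop := energy_drop_closedDisc hd
  have hdrop' : 2 * t / n ^ 2 - t ^ 2 / (a ^ 2 * n ^ 4) - 4 * a * δ - δ ^ 2 ≤ a ^ 2 - u.im ^ 2 := by
    have e1 : 2 * (-(v.im * K.im)) / ‖K‖ ^ 2 = 2 * t / n ^ 2 := by rw [htdef]
    have e2 : K.im ^ 2 / ‖K‖ ^ 4 = t ^ 2 / (a ^ 2 * n ^ 4) := by rw [htdef, ← hn]; field_simp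
    have h3 : 2 * |(v - K⁻¹).im| * δ ≤ 4 * a * δ := by nlinarith [abs_nonneg ((v - K⁻¹).im)]
    rw [e1, e2] at hdrop
    linarith
  have hV : κ ^ 2 * (2 * t / n ^ 2 - t ^ 2 / (a ^ 2 * n ^ 4) - 4 * a * δ - δ ^ 2) ≤ (a ^ 2 - u.im ^ 2) * κ ^ 2 := by
    rw [mul_comm]; exact mul_le_mul_of_nonneg_right hdrop' (sq_nonneg κ)
  have hkey : κ ^ 2 * (2 * t / n ^ 2 - t ^ 2 / (a ^ 2 * n ^ 4) - 4 * a * δ - δ ^ 2) =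
      2 * t * (a * κ) ^ 2 / (a * n) ^ 2 - (a * κ) ^ 2 * t ^ 2 / (a * n) ^ 4 - (36 / 5) * μ₀ * (a * κ) ^ 2 / (a * n) ^ 3
        - (81 / 25) * μ₀ ^ 2 * (a * κ) ^ 2 / (a * n) ^ 6 := by
    rw [hδ]; field_simp; ring
  have hreal := vdisc_mid_real (k := a * κ) (L := a * n) hfl (by positivity) hkL ht1 ht2 hμ0 hμ
  rw [← hkey] at hreal
  exact hreal.trans hV

/-! ## §2 The z-disc with `t_z ≥ 5` and the weight ratio -/

/-- §2 THE z-DISC TAIL: `Im K < 0`, `47/2 ≤ Im z·‖K‖`, `5 ≤ t_z = −Im z·Im K`, closed sharp door ⇒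
`κ₂·(460/47)/‖K‖² − κ₂·(2·Im z·δ + δ²) ≤ (Im z² − Im u²)·κ₂` (main terms `(t/n²)(2 − t/(b²n²)) ≥ (5/n²)(2 − 2/47)`). -/
theorem zdisc_tail {z K u : ℂ} {μ₀ κ₂ : ℝ} (hz : 0 < z.im) (hκ : 0 ≤ κ₂) (hμ0 : 0 ≤ μ₀) (hKim : K.im < 0) (hq : 47 / 2 ≤ z.im * ‖K‖)
    (ht5 : 5 ≤ -(z.im * K.im)) (hd : ‖u - (z - K⁻¹)‖ ≤ (9 / 5) * (μ₀ / (z.im * ‖K‖) ^ 2) / ‖K‖) :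
    κ₂ * ((460 / 47) / ‖K‖ ^ 2)
        - κ₂ * (2 * z.im * ((9 / 5) * (μ₀ / (z.im * ‖K‖) ^ 2) / ‖K‖) + ((9 / 5) * (μ₀ / (z.im * ‖K‖) ^ 2) / ‖K‖) ^ 2) ≤
      (z.im ^ 2 - u.im ^ 2) * κ₂ := by
  set b := z.im with hb
  set n := ‖K‖ with hn
  set t := -(b * K.im) with htdef
  set δ := (9 / 5) * (μ₀ / (b * n) ^ 2) / n with hδ
  have hK0 : K ≠ 0 := fun h => by rw [h] at hKim; simp at hKim
  have hn0 : 0 < n := norm_pos_iff.mpr hK0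
  have htL : t ≤ b * n := neg_im_mul_le hz.le
  have hδ0 : 0 ≤ δ := by positivity
  have htbn : t ≤ b ^ 2 * n ^ 2 := by nlinarith [mul_nonneg hz.le hn0.le]
  have hc : |(z - K⁻¹).im| ≤ b := by
    rw [im_newtonPoint]
    have e : K.im = -t / b := by rw [htdef]; field_simp
    have h1 : 0 ≤ t / (b * n ^ 2) := by positivity
    have h2 : t / (b * n ^ 2) ≤ b := by
      rw [div_le_iff₀ (by positivity)]; nlinarith
    have e2 : b + K.im / n ^ 2 = b - t / (b * n ^ 2) := by rw [e]; field_simp; ring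
    rw [← hb, e2, abs_le]
    constructor <;> linarith
  have hdrop := energy_drop_closedDisc hd
  -- main terms ≥ (460/47)/n²
  have hmain : (460 / 47) / n ^ 2 ≤ 2 * (-(z.im * K.im)) / ‖K‖ ^ 2 - K.im ^ 2 / ‖K‖ ^ 4 := by
    have e1 : 2 * (-(z.im * K.im)) / ‖K‖ ^ 2 - K.im ^ 2 / ‖K‖ ^ 4 = (2 * t * (b * n) ^ 2 - t ^ 2) / (b ^ 2 * n ^ 4) := by
      rw [htdef, ← hn, ← hb]; field_simp
    have e2 : (460 / 47) / n ^ 2 = ((460 / 47) * b ^ 2 * n ^ 2) / (b ^ 2 * n ^ 4) := by field_simp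
    rw [e1, e2]
    apply div_le_div_of_nonneg_right _ (by positivity)
    set q := b * n with hqdef
    have hq0 : 0 ≤ 2 * t - 39 / 4 := by linarith
    have s1 : (2 * t - 39 / 4) * ((47 / 2) * q) ≤ (2 * t - 39 / 4) * q ^ 2 := mul_le_mul_of_nonneg_left (by nlinarith) hq0
    have s2 : (47 * t - 1833 / 8) * t ≤ (47 * t - 1833 / 8) * q := mul_le_mul_of_nonneg_left htL (by linarith)
    have e3 : (460 / 47) * b ^ 2 * n ^ 2 = (460 / 47) * q ^ 2 := by rw [hqdef]; ring
    rw [e3]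
    nlinarith
  have h3 : 2 * |(z - K⁻¹).im| * δ ≤ 2 * b * δ := by nlinarith [abs_nonneg ((z - K⁻¹).im)]
  have h4 : (460 / 47) / n ^ 2 - (2 * b * δ + δ ^ 2) ≤ b ^ 2 - u.im ^ 2 := by linarith
  have h5 := mul_le_mul_of_nonneg_right h4 hκ
  linarith

/-- §2 THE WEIGHT RATIO `ω = κ²/‖K_z‖² ≥ 17/25`: coherence `‖K_z − K_v‖ ≤ 6/Im v`, `t_v ≤ 3/2`, floor `59/2 ≤ Im v·‖K_v‖` ⇒ `(17/25)‖K_z‖² ≤ κ²`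
(`κ² = ‖K_v‖² − (t_v − 1/4)/Im v²`, H (I2)). -/
theorem weight_ratio {v Kv Kz : ℂ} (hv : 0 < v.im) (hcoh : ‖Kz - Kv‖ ≤ 6 / v.im) (ht2 : -(v.im * Kv.im) ≤ 3 / 2) (hL : 59 / 2 ≤ v.im * ‖Kv‖) :
    (17 / 25) * ‖Kz‖ ^ 2 ≤ ‖Kv + I / (2 * (v.im : ℂ))‖ ^ 2 := by
  set a := v.im with ha
  have hκ2 : ‖Kv + I / (2 * (a : ℂ))‖ ^ 2 = ‖Kv‖ ^ 2 - (-(a * Kv.im) - 1 / 4) / a ^ 2 := normSq_tilt_t Kv hv.ne'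
  have h1 : ‖Kz‖ ≤ ‖Kv‖ + 6 / a := by
    have h := norm_sub_norm_le Kz Kv
    linarith
  have h2 : ‖Kz‖ ^ 2 ≤ (‖Kv‖ + 6 / a) ^ 2 := pow_le_pow_left₀ (norm_nonneg _) h1 2
  rw [hκ2]
  -- (17/25)(n + 6/a)² ≤ n² − (5/4)/a², i.e. (17/25)(L+6)² ≤ L² − 5/4 with L = a n ≥ 59/2
  have hL0 : 0 ≤ ‖Kv‖ := norm_nonneg _
  have key : (17 / 25) * (‖Kv‖ + 6 / a) ^ 2 ≤ ‖Kv‖ ^ 2 - (5 / 4) / a ^ 2 := by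
    have e1 : (17 / 25) * (‖Kv‖ + 6 / a) ^ 2 = ((17 / 25) * (a * ‖Kv‖ + 6) ^ 2) / a ^ 2 := by field_simp
    have e2 : ‖Kv‖ ^ 2 - (5 / 4) / a ^ 2 = ((a * ‖Kv‖) ^ 2 - 5 / 4) / a ^ 2 := by field_simp
    rw [e1, e2]
    apply div_le_div_of_nonneg_right _ (by positivity)
    nlinarith [sq_nonneg (a * ‖Kv‖ - 59 / 2)]
  have h3 : (-(a * Kv.im) - 1 / 4) / a ^ 2 ≤ (5 / 4) / a ^ 2 := div_le_div_of_nonneg_right (by linarith) (by positivity)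
  linarith

/-- §2 the z-doors in `λ`-currency on the nine numbers: `κ²·(2·Im z·δ_z + δ_z²) ≤ 5/(Im v·κ)` (identity + J `zdoors_real`). -/
theorem zdoors_bound {a b κ nz μ₀ : ℝ} (ha : 0 < a) (hb : 0 < b) (hnz : 0 < nz) (hlam : 30 ≤ a * κ)
    (hm47 : (47 / 60) * (a * κ) ≤ a * nz) (hqm : a * nz ≤ b * nz) (hμ0 : 0 ≤ μ₀) (hμ : μ₀ ≤ 1 / 2) :
    κ ^ 2 * (2 * b * ((9 / 5) * (μ₀ / (b * nz) ^ 2) / nz) + ((9 / 5) * (μ₀ / (b * nz) ^ 2) / nz) ^ 2) ≤ 5 / (a * κ) := by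
  have e : κ ^ 2 * (2 * b * ((9 / 5) * (μ₀ / (b * nz) ^ 2) / nz) + ((9 / 5) * (μ₀ / (b * nz) ^ 2) / nz) ^ 2) =
      (18 / 5) * μ₀ * (a * κ) ^ 2 / ((b * nz) * (a * nz) ^ 2) + (81 / 25) * μ₀ ^ 2 * (a * κ) ^ 2 / ((b * nz) ^ 4 * (a * nz) ^ 2) := by
    field_simp
    ring
  rw [e]
  exact zdoors_real hlam hm47 hqm hμ0 hμ

/-- §2 `t_v ≥ −3/2` on the nine numbers: explicit `K_v`, `Im R_v ≤ 0`, separation ⇒ `−3/2 ≤ −Im v·Im K_v` (mate `1/2` − pull `≤ 2` − `Im v·Im R_v ≤ 0`). -/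
theorem tv_lower {v z Rv Kv : ℂ} (hv : 0 < v.im) (hvz : v.im < z.im) (hsep : v.im ≤ 2 * ‖v - z‖)
    (hKv : Kv = (v - conj v)⁻¹ + (v - z)⁻¹ + (v - conj z)⁻¹ + Rv) (hRv : Rv.im ≤ 0) : -(3 / 2) ≤ -(v.im * Kv.im) := by
  have e : Kv.im = -(1 / (2 * v.im)) + pairPull v z + Rv.im := by rw [hKv, add_im, im_explicit]
  have hP := pairPull_le_of_sep hv hvz hsep
  have e2 : -(v.im * Kv.im) = 1 / 2 - v.im * pairPull v z - v.im * Rv.im := by rw [e]; field_simp; ring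
  rw [e2]
  have h1 : v.im * pairPull v z ≤ 2 := by
    have := mul_le_mul_of_nonneg_left hP hv.le
    rwa [show v.im * (2 / v.im) = 2 by field_simp] at this
  nlinarith [mul_nonpos_iff.mpr (Or.inl ⟨hv.le, hRv⟩)]

/-! ## §3 Case (B1) and the perturbative box -/

/-- ★★ §3 **CASE (B1) OF `GeometricBudget 10 μ₀` (`μ₀ ≤ 1/2`)**: a sub-list of GeometricBudget's binders + `−Im v·Im K_v < 3/2` + `5 ≤ −Im z·Im K_z` ⇒
its conclusion with `C = 10`. -/
theorem budget_caseB1 {v z Rv Rz Kv Kz u₁ u₂ : ℂ} {M μ₀ : ℝ} (hμ : μ₀ ≤ 1 / 2)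
    (hv : 0 < v.im) (hvz : v.im < z.im) (ht : |v.re - z.re| ≤ v.im + z.im) (hsep : v.im ≤ 2 * ‖v - z‖) (hM0 : 0 ≤ M) (hMμ : M ≤ μ₀)
    (hKv : Kv = (v - conj v)⁻¹ + (v - z)⁻¹ + (v - conj z)⁻¹ + Rv) (hKz : Kz = (z - conj z)⁻¹ + (z - v)⁻¹ + (z - conj v)⁻¹ + Rz)
    (hRv : Rv.im ≤ 0) (hRz : Rz.im ≤ 0) (hR : ‖Rz - Rv‖ ≤ M * ‖z - v‖ / (v.im * z.im))
    (hflv : 30 ≤ v.im * ‖Kv + I / (2 * (v.im : ℂ))‖)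
    (hd₁ : ‖u₁ - (v - Kv⁻¹)‖ ≤ (9 / 5) * (μ₀ / (v.im * ‖Kv‖) ^ 2) / ‖Kv‖)
    (hd₂ : ‖u₂ - (z - Kz⁻¹)‖ ≤ (9 / 5) * (μ₀ / (z.im * ‖Kz‖) ^ 2) / ‖Kz‖)
    (hB : -(v.im * Kv.im) < 3 / 2) (h5 : 5 ≤ -(z.im * Kz.im)) :
    3 - 10 * (1 + μ₀) / (v.im * ‖Kv + I / (2 * (v.im : ℂ))‖) ≤
      ((v.im ^ 2 + z.im ^ 2) - (u₁.im ^ 2 + u₂.im ^ 2)) * ‖Kv + I / (2 * (v.im : ℂ))‖ ^ 2 := by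
  have hb : 0 < z.im := hv.trans hvz
  have hμ0 : 0 ≤ μ₀ := hM0.trans hMμ
  have hlam0 : 0 < v.im * ‖Kv + I / (2 * (v.im : ℂ))‖ := by linarith
  -- the v-disc: t_v ≥ −3/2 and the middle-range bound
  have htv : -(3 / 2) ≤ -(v.im * Kv.im) := tv_lower hv hvz hsep hKv hRv
  have hV := vdisc_mid (u := u₁) hv hμ0 hμ hflv htv hB.le hd₁
  -- the z side: sign, size, coherence
  have hKzim : Kz.im < 0 := by
    have h := im_Kz_le hv hvz hKz hRz
    have : 0 < 1 / (2 * z.im) := by positivity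
    linarith
  have hKz0 : Kz ≠ 0 := fun h => by rw [h] at hKzim; simp at hKzim
  have hnz0 : 0 < ‖Kz‖ := norm_pos_iff.mpr hKz0
  have hcoh : ‖Kz - Kv‖ ≤ 6 / v.im := explicit_coherence hv hvz ht hsep (hMμ.trans hμ) hKv hKz hR
  have hnv : v.im * ‖Kv + I / (2 * (v.im : ℂ))‖ - 1 / 2 ≤ v.im * ‖Kv‖ := im_mul_norm_ge hv
  have hm : v.im * ‖Kv + I / (2 * (v.im : ℂ))‖ - 13 / 2 ≤ v.im * ‖Kz‖ := by
    have h1 : ‖Kv‖ - ‖Kz‖ ≤ ‖Kv - Kz‖ := norm_sub_norm_le _ _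
    rw [norm_sub_rev] at h1
    have h2 : v.im * (‖Kv‖ - ‖Kz‖) ≤ v.im * (6 / v.im) := mul_le_mul_of_nonneg_left (h1.trans hcoh) hv.le
    rw [mul_sub, show v.im * (6 / v.im) = 6 by field_simp] at h2
    linarith
  have hm47 : (47 / 60) * (v.im * ‖Kv + I / (2 * (v.im : ℂ))‖) ≤ v.im * ‖Kz‖ := by linarith
  have hqm : v.im * ‖Kz‖ ≤ z.im * ‖Kz‖ := mul_le_mul_of_nonneg_right hvz.le hnz0.le
  have hq : 47 / 2 ≤ z.im * ‖Kz‖ := by linarith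
  have hZ := zdisc_tail (κ₂ := ‖Kv + I / (2 * (v.im : ℂ))‖ ^ 2) hb (sq_nonneg _) hμ0 hKzim hq h5 hd₂
  have hT := zdoors_bound hv hb hnz0 hflv hm47 hqm hμ0 hμ
  -- weight ratio ⇒ the z main term ≥ (17/25)(460/47)
  have hω : (17 / 25) * ‖Kz‖ ^ 2 ≤ ‖Kv + I / (2 * (v.im : ℂ))‖ ^ 2 := weight_ratio hv hcoh hB.le (by linarith)
  have hZmain : (17 / 25) * (460 / 47) ≤ ‖Kv + I / (2 * (v.im : ℂ))‖ ^ 2 * ((460 / 47) / ‖Kz‖ ^ 2) := by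
    have e5 : ‖Kv + I / (2 * (v.im : ℂ))‖ ^ 2 * ((460 / 47) / ‖Kz‖ ^ 2) = (460 / 47) * ‖Kv + I / (2 * (v.im : ℂ))‖ ^ 2 / ‖Kz‖ ^ 2 := by
      ring
    have h6 := mul_le_mul_of_nonneg_left hω (by norm_num : (0:ℝ) ≤ 460 / 47)
    rw [e5, le_div_iff₀ (by positivity)]
    linarith
  -- assemble
  have hsplit : ((v.im ^ 2 + z.im ^ 2) - (u₁.im ^ 2 + u₂.im ^ 2)) * ‖Kv + I / (2 * (v.im : ℂ))‖ ^ 2 =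
      (v.im ^ 2 - u₁.im ^ 2) * ‖Kv + I / (2 * (v.im : ℂ))‖ ^ 2 + (z.im ^ 2 - u₂.im ^ 2) * ‖Kv + I / (2 * (v.im : ℂ))‖ ^ 2 := by ring
  have hC : 10 / (v.im * ‖Kv + I / (2 * (v.im : ℂ))‖) ≤ 10 * (1 + μ₀) / (v.im * ‖Kv + I / (2 * (v.im : ℂ))‖) :=
    div_le_div_of_nonneg_right (by linarith) hlam0.le
  have h10 : 5 / (v.im * ‖Kv + I / (2 * (v.im : ℂ))‖) ≤ 10 / (v.im * ‖Kv + I / (2 * (v.im : ℂ))‖) :=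
    div_le_div_of_nonneg_right (by norm_num) hlam0.le
  rw [hsplit]
  linarith only [hV, hZ, hT, hZmain, htv, hC, h10]

/-- ★★★ §3 **`GeometricBudget 10 μ₀` (`μ₀ ≤ 1/2`) FROM THE PERTURBATIVE BOX `t_v < 3/2 ∧ t_z < 5`** (cases (A) = image J and (B1) = `budget_caseB1` discharged). -/
theorem geometricBudget_ten_of_box {μ₀ : ℝ} (hμ : μ₀ ≤ 1 / 2)
    (h : GeometricBudgetOn (fun v z Kv Kz => -(v.im * Kv.im) < 3 / 2 ∧ -(z.im * Kz.im) < 5) 10 μ₀) : GeometricBudget 10 μ₀ := by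
  refine geometricBudget_ten_of_tv_lt hμ (geometricBudgetOn_of_split (P := fun _ z _ Kz => -(z.im * Kz.im) < 5) h ?_)
  intro v z Rv Rz Kv Kz u₁ u₂ M hP hv hvz ht hsep hM0 hMμ hKv hKz hRv hRz hR hflv _hflz hd₁ hd₂
  exact budget_caseB1 hμ hv hvz ht hsep hM0 hMμ hKv hKz hRv hRz hR hflv hd₁ hd₂ hP.1 (not_lt.mp hP.2)

end RhW08.BudgetCaseB1
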